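import Literature.MathematicalPhysics.QuantumLattice.LatticeGaugeDLRGibbsProofs

/-!
# Stub `stub_lower` of line `dlr-collar-transfer` (crux `OSLegsFromFemtoAndGap`, stmt-QuantumFields-9367):
# auxiliary file 2 — laws of total covariance / cumulance as inequalities

Abstract probability inequalities on a compact configuration space `Ω` with a Borel probability
measure `μ` (the torus Wilson state) for continuous "kernel averages" `g_A = γ_Λ A ∘ lift`, …:

* `sub_mul_mul_le_cov_of_kernel` (two-point): if `γ(AB) - γA·γB ≥ m` pointwise (conditional
  covariance floor) and `|γA - p| ≤ h`, `|γB - q| ≤ h'` (boundary law), then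
  `∫ γ(AB) - (∫ γA)(∫ γB) ≥ m - 4 h h'` — the law of total covariance
  `Cov = E[Cov(·|ext)] + Cov(E[A|ext], E[B|ext])` with the second term bounded by sup-norms;
* `cumulant3_lower_of_kernel` (three-point): the analogous bound for the third cumulant
  combination `E[ABC] - E[A]E[BC] - E[B]E[AC] - E[C]E[AB] + 2E[A]E[B]E[C]` from a signed floor
  on the conditional third cumulant, sup bounds on the conditional covariances and the boundary
  law: law of total cumulance `κ₃ = E[κ₃(·|ext)] + Σ Cov(E[A|ext], Cov(B,C|ext)) + κ₃(E[A|ext], …)`.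

Pure measure theory (Mathlib); no lattice notion enters.
-/

set_option autoImplicit false

noncomputable section

open MeasureTheory

namespace Summit.QuantumFields.YangMills.Theorems.OSLegsFromFemtoAndGap.StubLower

section Moments

variable {Ω : Type*} [TopologicalSpace Ω] [CompactSpace Ω] [MeasurableSpace Ω]
  [OpensMeasurableSpace Ω] {μ : Measure Ω} [IsProbabilityMeasure μ]

/-- A continuous real function on a compact space is integrable for a finite Borel measure. [folklore] -/
theorem integrable_of_continuous_compact {f : Ω → ℝ} (hf : Continuous f) : Integrable f μ := by
  obtain ⟨C, hC⟩ := Literature.MathematicalPhysics.QuantumLattice.exists_bound_of_continuous hf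
  exact Literature.MathematicalPhysics.QuantumLattice.integrable_of_bound hf.aestronglyMeasurable hC

/-- The mean of a function within `h` of the constant `p` is within `h` of `p`. [folklore] -/
theorem abs_integral_sub_const_le {f : Ω → ℝ} (hf : Continuous f) {p h : ℝ}
    (hd : ∀ ω, |f ω - p| ≤ h) : |∫ ω, f ω ∂μ - p| ≤ h := by
  have h1 : ∫ ω, f ω ∂μ - p = ∫ ω, (f ω - p) ∂μ := by
    rw [integral_sub (integrable_of_continuous_compact hf) (integrable_const p), integral_const]
    simp
  rw [h1, ← Real.norm_eq_abs]
  have := norm_integral_le_of_norm_le_const (μ := μ) (f := fun ω => f ω - p) (C := h)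
    (ae_of_all _ fun ω => by simpa [Real.norm_eq_abs] using hd ω)
  simpa using this

/-- **Law of total covariance, as a lower bound.** On a probability space let `gAB, gA, gB` be
(continuous) conditional expectations of `AB, A, B` given the exterior, with the conditional
covariance floor `gAB - gA·gB ≥ m` and the boundary law `|gA - p| ≤ h`, `|gB - q| ≤ h'`.  Then
`Cov(A, B) = ∫ gAB - (∫ gA)(∫ gB) ≥ m - 4 h h'`. [folklore] -/
theorem sub_mul_mul_le_cov_of_kernel {gA gB gAB : Ω → ℝ} (hA : Continuous gA)
    (hB : Continuous gB) (hAB : Continuous gAB) {p q h h' m : ℝ} (hdA : ∀ ω, |gA ω - p| ≤ h)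
    (hdB : ∀ ω, |gB ω - q| ≤ h') (hfl : ∀ ω, m ≤ gAB ω - gA ω * gB ω) :
    m - 4 * h * h' ≤ ∫ ω, gAB ω ∂μ - (∫ ω, gA ω ∂μ) * (∫ ω, gB ω ∂μ) := by
  set mA := ∫ ω, gA ω ∂μ with hmA
  set mB := ∫ ω, gB ω ∂μ with hmB
  have hpA : |mA - p| ≤ h := abs_integral_sub_const_le hA hdA
  have hpB : |mB - q| ≤ h' := abs_integral_sub_const_le hB hdB
  have hdevA : ∀ ω, |gA ω - mA| ≤ 2 * h := fun ω => by
    have : gA ω - mA = (gA ω - p) - (mA - p) := by ring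
    rw [this]
    exact (abs_sub _ _).trans (by linarith [hdA ω])
  have hdevB : ∀ ω, |gB ω - mB| ≤ 2 * h' := fun ω => by
    have : gB ω - mB = (gB ω - q) - (mB - q) := by ring
    rw [this]
    exact (abs_sub _ _).trans (by linarith [hdB ω])
  have iA : Integrable gA μ := integrable_of_continuous_compact hA
  have iB : Integrable gB μ := integrable_of_continuous_compact hB
  have iAB : Integrable gAB μ := integrable_of_continuous_compact hAB
  have iprod : Integrable (fun ω => (gA ω - mA) * (gB ω - mB)) μ :=
    integrable_of_continuous_compact ((hA.sub continuous_const).mul (hB.sub continuous_const))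
  have idiff : Integrable (fun ω => gAB ω - gA ω * gB ω) μ :=
    integrable_of_continuous_compact (hAB.sub (hA.mul hB))
  -- the law of total covariance
  have hsplit : ∫ ω, gAB ω ∂μ - mA * mB =
      ∫ ω, ((gAB ω - gA ω * gB ω) + (gA ω - mA) * (gB ω - mB)) ∂μ := by
    have e : (fun ω => (gAB ω - gA ω * gB ω) + (gA ω - mA) * (gB ω - mB)) =
        fun ω => (gAB ω - mA * gB ω - mB * gA ω) + mA * mB := by
      funext ω; ring
    have i1 : Integrable (fun ω => gAB ω - mA * gB ω) μ := iAB.sub (iB.const_mul mA)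
    have i2 : Integrable (fun ω => gAB ω - mA * gB ω - mB * gA ω) μ := i1.sub (iA.const_mul mB)
    rw [e, integral_add i2 (integrable_const _), integral_sub i1 (iA.const_mul mB),
      integral_sub iAB (iB.const_mul mA), integral_const_mul, integral_const_mul, integral_const]
    simp only [probReal_univ, smul_eq_mul, one_mul]
    ring
  rw [hsplit]
  have hpt : ∀ ω, m - 4 * h * h' ≤ (gAB ω - gA ω * gB ω) + (gA ω - mA) * (gB ω - mB) := fun ω => by
    have h1 : |(gA ω - mA) * (gB ω - mB)| ≤ 2 * h * (2 * h') := by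
      rw [abs_mul]
      exact mul_le_mul (hdevA ω) (hdevB ω) (abs_nonneg _) ((abs_nonneg _).trans (hdevA ω))
    have h2 := neg_abs_le ((gA ω - mA) * (gB ω - mB))
    have h3 := hfl ω
    nlinarith
  calc m - 4 * h * h' = ∫ _ω, (m - 4 * h * h') ∂μ := by simp
    _ ≤ _ := integral_mono (integrable_const _) (idiff.add iprod) hpt

/-- **Law of total cumulance (third order), as a signed lower bound.** Conditional expectations
`F₁, F₂, F₃, F₁₂, F₁₃, F₂₃, F₁₂₃` of `A, B, C, AB, AC, BC, ABC` given the exterior (continuous in the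
exterior), boundary law `|Fᵢ - p| ≤ h₀`, conditional covariances bounded `|F_{jk} - F_j F_k| ≤ c`,
and a SIGNED floor `σ κ₃(·|ext) ≥ fl` (`σ = ±1`) on the conditional third cumulant
`κ₃(·|ext) = F₁₂₃ - F₁F₂₃ - F₂F₁₃ - F₃F₁₂ + 2F₁F₂F₃`.  Then the total third cumulant
`κ₃ = ∫F₁₂₃ - m₁∫F₂₃ - m₂∫F₁₃ - m₃∫F₁₂ + 2m₁m₂m₃` (`mᵢ = ∫Fᵢ`) satisfies
`σ κ₃ ≥ fl - 6 h₀ c - 8 h₀³`: indeed `κ₃ = ∫κ₃(·|ext) + Σᵢ ∫hᵢ C_{jk} + ∫h₁h₂h₃` with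
`hᵢ = Fᵢ - mᵢ`, `|hᵢ| ≤ 2h₀`. [folklore] -/
theorem cumulant3_lower_of_kernel {F₁ F₂ F₃ F₁₂ F₁₃ F₂₃ F₁₂₃ : Ω → ℝ} (h₁ : Continuous F₁)
    (h₂ : Continuous F₂) (h₃ : Continuous F₃) (h₁₂ : Continuous F₁₂) (h₁₃ : Continuous F₁₃)
    (h₂₃ : Continuous F₂₃) (h₁₂₃ : Continuous F₁₂₃) {p h₀ c fl σ : ℝ} (hσ : σ = 1 ∨ σ = -1)
    (hd₁ : ∀ ω, |F₁ ω - p| ≤ h₀) (hd₂ : ∀ ω, |F₂ ω - p| ≤ h₀) (hd₃ : ∀ ω, |F₃ ω - p| ≤ h₀)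
    (hc₂₃ : ∀ ω, |F₂₃ ω - F₂ ω * F₃ ω| ≤ c) (hc₁₃ : ∀ ω, |F₁₃ ω - F₁ ω * F₃ ω| ≤ c)
    (hc₁₂ : ∀ ω, |F₁₂ ω - F₁ ω * F₂ ω| ≤ c)
    (hfl : ∀ ω, fl ≤ σ * (F₁₂₃ ω - F₁ ω * F₂₃ ω - F₂ ω * F₁₃ ω - F₃ ω * F₁₂ ω
      + 2 * (F₁ ω * F₂ ω * F₃ ω))) :
    fl - 6 * h₀ * c - 8 * h₀ ^ 3 ≤ σ * (∫ ω, F₁₂₃ ω ∂μ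
      - (∫ ω, F₁ ω ∂μ) * (∫ ω, F₂₃ ω ∂μ) - (∫ ω, F₂ ω ∂μ) * (∫ ω, F₁₃ ω ∂μ)
      - (∫ ω, F₃ ω ∂μ) * (∫ ω, F₁₂ ω ∂μ)
      + 2 * ((∫ ω, F₁ ω ∂μ) * (∫ ω, F₂ ω ∂μ) * (∫ ω, F₃ ω ∂μ))) := by
  set m₁ := ∫ ω, F₁ ω ∂μ with hm₁
  set m₂ := ∫ ω, F₂ ω ∂μ with hm₂
  set m₃ := ∫ ω, F₃ ω ∂μ with hm₃
  have I : ∀ {f : Ω → ℝ}, Continuous f → Integrable f μ := fun hf =>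
    integrable_of_continuous_compact hf
  have hdev : ∀ {F : Ω → ℝ}, Continuous F → (∀ ω, |F ω - p| ≤ h₀) →
      ∀ ω, |F ω - ∫ ω', F ω' ∂μ| ≤ 2 * h₀ := by
    intro F hF hd ω
    have hm : |∫ ω', F ω' ∂μ - p| ≤ h₀ := abs_integral_sub_const_le hF hd
    have : F ω - ∫ ω', F ω' ∂μ = (F ω - p) - (∫ ω', F ω' ∂μ - p) := by ring
    rw [this]
    exact (abs_sub _ _).trans (by linarith [hd ω])
  have hz : ∀ {F : Ω → ℝ}, Continuous F → ∫ ω, (F ω - ∫ ω', F ω' ∂μ) ∂μ = 0 := by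
    intro F hF
    rw [integral_sub (I hF) (integrable_const _), integral_const]
    simp
  -- linearity: σ κ₃ as one integral
  have iT₁ : Integrable (fun ω => F₁₂₃ ω - m₁ * F₂₃ ω) μ := (I h₁₂₃).sub ((I h₂₃).const_mul m₁)
  have iT₂ : Integrable (fun ω => F₁₂₃ ω - m₁ * F₂₃ ω - m₂ * F₁₃ ω) μ :=
    iT₁.sub ((I h₁₃).const_mul m₂)
  have iT : Integrable (fun ω => F₁₂₃ ω - m₁ * F₂₃ ω - m₂ * F₁₃ ω - m₃ * F₁₂ ω) μ :=
    iT₂.sub ((I h₁₂).const_mul m₃)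
  have hlin : (∫ ω, F₁₂₃ ω ∂μ) - m₁ * (∫ ω, F₂₃ ω ∂μ) - m₂ * (∫ ω, F₁₃ ω ∂μ)
      - m₃ * (∫ ω, F₁₂ ω ∂μ) + 2 * (m₁ * m₂ * m₃) =
      ∫ ω, (F₁₂₃ ω - m₁ * F₂₃ ω - m₂ * F₁₃ ω - m₃ * F₁₂ ω + 2 * (m₁ * m₂ * m₃)) ∂μ := by
    rw [integral_add iT (integrable_const _), integral_sub iT₂ ((I h₁₂).const_mul m₃),
      integral_sub iT₁ ((I h₁₃).const_mul m₂), integral_sub (I h₁₂₃) ((I h₂₃).const_mul m₁),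
      integral_const_mul, integral_const_mul, integral_const_mul, integral_const]
    simp only [probReal_univ, smul_eq_mul, one_mul]
  rw [hlin, ← integral_const_mul]
  -- pointwise decomposition: σ T = G + σ·(terms with zero mean)
  set G : Ω → ℝ := fun ω =>
    σ * (F₁₂₃ ω - F₁ ω * F₂₃ ω - F₂ ω * F₁₃ ω - F₃ ω * F₁₂ ω + 2 * (F₁ ω * F₂ ω * F₃ ω))
    + σ * ((F₁ ω - m₁) * (F₂₃ ω - F₂ ω * F₃ ω) + (F₂ ω - m₂) * (F₁₃ ω - F₁ ω * F₃ ω)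
      + (F₃ ω - m₃) * (F₁₂ ω - F₁ ω * F₂ ω) + (F₁ ω - m₁) * (F₂ ω - m₂) * (F₃ ω - m₃))
    with hG
  have hGc : Continuous G := by
    simp only [hG]
    fun_prop
  have hpt : ∀ ω, σ * (F₁₂₃ ω - m₁ * F₂₃ ω - m₂ * F₁₃ ω - m₃ * F₁₂ ω + 2 * (m₁ * m₂ * m₃)) =
      G ω - σ * (m₁ * m₂) * (F₃ ω - m₃) - σ * (m₁ * m₃) * (F₂ ω - m₂)
        - σ * (m₂ * m₃) * (F₁ ω - m₁) := fun ω => by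
    simp only [hG]; ring
  have hint : ∫ ω, σ * (F₁₂₃ ω - m₁ * F₂₃ ω - m₂ * F₁₃ ω - m₃ * F₁₂ ω + 2 * (m₁ * m₂ * m₃)) ∂μ
      = ∫ ω, G ω ∂μ := by
    simp_rw [hpt]
    have j₃ : Integrable (fun ω => σ * (m₁ * m₂) * (F₃ ω - m₃)) μ :=
      (I (h₃.sub continuous_const)).const_mul _
    have j₂ : Integrable (fun ω => σ * (m₁ * m₃) * (F₂ ω - m₂)) μ :=
      (I (h₂.sub continuous_const)).const_mul _
    have j₁ : Integrable (fun ω => σ * (m₂ * m₃) * (F₁ ω - m₁)) μ :=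
      (I (h₁.sub continuous_const)).const_mul _
    have k₁ : Integrable (fun ω => G ω - σ * (m₁ * m₂) * (F₃ ω - m₃)) μ := (I hGc).sub j₃
    have k₂ : Integrable (fun ω => G ω - σ * (m₁ * m₂) * (F₃ ω - m₃)
        - σ * (m₁ * m₃) * (F₂ ω - m₂)) μ := k₁.sub j₂
    rw [integral_sub k₂ j₁, integral_sub k₁ j₂, integral_sub (I hGc) j₃,
      integral_const_mul, integral_const_mul, integral_const_mul, hz h₁, hz h₂, hz h₃]
    ring
  rw [hint]
  -- pointwise lower bound on G
  have hσabs : ∀ x : ℝ, -|x| ≤ σ * x := fun x => by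
    rcases hσ with rfl | rfl
    · simpa using neg_abs_le x
    · simpa using (le_abs_self x)
  have amul : ∀ {x y u w : ℝ}, |x| ≤ u → |y| ≤ w → |x * y| ≤ u * w := fun hx hy => by
    rw [abs_mul]; exact mul_le_mul hx hy (abs_nonneg _) ((abs_nonneg _).trans hx)
  have hGpt : ∀ ω, fl - 6 * h₀ * c - 8 * h₀ ^ 3 ≤ G ω := fun ω => by
    have e₁ := hdev h₁ hd₁ ω
    have e₂ := hdev h₂ hd₂ ω
    have e₃ := hdev h₃ hd₃ ω
    have b₁ := amul e₁ (hc₂₃ ω)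
    have b₂ := amul e₂ (hc₁₃ ω)
    have b₃ := amul e₃ (hc₁₂ ω)
    have b₄ := amul (amul e₁ e₂) e₃
    have t := hσabs ((F₁ ω - m₁) * (F₂₃ ω - F₂ ω * F₃ ω) + (F₂ ω - m₂) * (F₁₃ ω - F₁ ω * F₃ ω)
      + (F₃ ω - m₃) * (F₁₂ ω - F₁ ω * F₂ ω) + (F₁ ω - m₁) * (F₂ ω - m₂) * (F₃ ω - m₃))
    have tri := abs_add_le ((F₁ ω - m₁) * (F₂₃ ω - F₂ ω * F₃ ω) + (F₂ ω - m₂) * (F₁₃ ω - F₁ ω * F₃ ω)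
      + (F₃ ω - m₃) * (F₁₂ ω - F₁ ω * F₂ ω)) ((F₁ ω - m₁) * (F₂ ω - m₂) * (F₃ ω - m₃))
    have tri₂ := abs_add_le ((F₁ ω - m₁) * (F₂₃ ω - F₂ ω * F₃ ω) + (F₂ ω - m₂) * (F₁₃ ω - F₁ ω * F₃ ω))
      ((F₃ ω - m₃) * (F₁₂ ω - F₁ ω * F₂ ω))
    have tri₃ := abs_add_le ((F₁ ω - m₁) * (F₂₃ ω - F₂ ω * F₃ ω))
      ((F₂ ω - m₂) * (F₁₃ ω - F₁ ω * F₃ ω))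
    have := hfl ω
    have hh₀ : 0 ≤ h₀ := (abs_nonneg _).trans (hd₁ ω)
    simp only [hG]
    nlinarith
  calc fl - 6 * h₀ * c - 8 * h₀ ^ 3 = ∫ _ω, (fl - 6 * h₀ * c - 8 * h₀ ^ 3) ∂μ := by simp
    _ ≤ ∫ ω, G ω ∂μ := integral_mono (integrable_const _) (I hGc) hGpt

end Moments

end Summit.QuantumFields.YangMills.Theorems.OSLegsFromFemtoAndGap.StubLower

end
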